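import Mathlib
import HarnessLib
import Literature.NumberTheory.LFunctions.ZetaSubconvexity
import Literature.NumberTheory.LFunctions.VanDerCorputDerivTests

/-!
# Bourgain's bound `|ζ(1/2 + it)| ≪ t^{13/84 + ε}` — proofs: the exponent-pair input (4.2) is
# dispensable

Topic `Literature/NumberTheory/LFunctions`. Sibling proof file of `ZetaSubconvexity.lean`
(the decomposition of the named fact `Literature.NumberTheory.LFunctions.bourgain_subconvexity`, Bourgain, *J. Amer. Math.
Soc.* **30** (2017), Theorem 5). There, (5.1) for `F = log` — and with it Theorem 5 — was
reduced to Bourgain's Theorem 4 (`Literature.NumberTheory.LFunctions.Bourgain2017_theorem4_log`), Huxley's estimate (4.1)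
(`Literature.NumberTheory.LFunctions.Bourgain2017_eq41_log`), the exponent pair `(1/9, 13/18)` (4.2)
(`Literature.NumberTheory.LFunctions.Bourgain2017_eq42_log`) and the approximate functional equation (4.3)
(`Literature.NumberTheory.LFunctions.Bourgain2017_eq43`). Here the named fact (4.2) is removed from that list: in Bourgain's
"calculation" (§5) the pair `(1/9, 13/18)` is only used on `0 ≤ α = log M / log T ≤ 12/31`
(its range of validity being `[0, 11/28]`), and on `[0, 7/18] ⊃ [0, 12/31]` the classical van
der Corput fourth-derivative test (exponent pair `(1/14, 11/14) = A²B(0, 1)`), PROVED in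
`VanDerCorputDerivTests.lean` (`Literature.NumberTheory.LFunctions.VdC.norm_sum_Icc_cpow_mul_I_le`), already gives (3.19):
`M^{5/7} T^{1/14} ≤ M^{1/2} T^{13/84}` iff `α ≤ 7/18 = 0.3888… > 0.3870… = 12/31`, and the
secondary term `M^{29/28} T^{-1/14} ≤ M^{1/2} T^{13/84}` iff `α ≤ 19/45 = 0.4222…`.

* `Literature.NumberTheory.LFunctions.norm_bourgainSum_log_le_fourthDeriv` — PROVED: for `T ≥ 1`, `M ≥ 1`,
  `‖S‖ = ‖∑_{M/2 ≤ m ≤ M} e(T log(m/M))‖ ≤ C (M^{5/7} T^{1/14} + M^{29/28} T^{-1/14})`.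
* `Literature.NumberTheory.LFunctions.Bourgain2017_eq319_log_small` — PROVED: (3.19) for `F = log` on `1 ≤ M ≤ T^{12/31}`
  (even without the `ε`): `‖S‖ ≤ C M^{1/2} T^{13/84}`.
* `Literature.NumberTheory.LFunctions.Bourgain2017_eq51_log_of_theorem4_of_eq41` — PROVED: (5.1)_{log} from Theorem 4 and
  (4.1) alone.
* `Literature.NumberTheory.LFunctions.bourgain_subconvexity_of_theorem4_of_eq41_of_eq43` — PROVED:
  `Literature.NumberTheory.LFunctions.bourgain_subconvexity` from Theorem 4, (4.1) and (4.3).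

* `Literature.NumberTheory.LFunctions.bourgain_subconvexity_of_theorem4_of_eq41_of_eq4171` — PROVED: the same with (4.3)
  replaced by the approximate functional equation in Titchmarsh's form (4.17.1)
  (`Literature.NumberTheory.LFunctions.Titchmarsh1986_eq4171`, via `Bourgain2017_eq43_of_eq4171`).

Remaining undischarged inputs of `Literature.NumberTheory.LFunctions.bourgain_subconvexity`: `Bourgain2017_theorem4_log`
(Bourgain–Demeter decoupling + the Bombieri–Iwaniec–Huxley method), `Bourgain2017_eq41_log`
(Huxley 1993, Thm 3), and `Titchmarsh1986_eq4171` (Hardy–Littlewood approximate functional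
equation on the critical line, Titchmarsh Thm 4.15 / (4.12.4) / (4.17.1)).

## References
* J. Bourgain, *Decoupling, exponential sums and the Riemann zeta function*, J. Amer. Math. Soc.
  30 (2017), 205–224 — §5 (the "calculation"), (4.1)–(4.3), (5.1), Theorem 5.
* E. C. Titchmarsh, *The Theory of the Riemann Zeta-Function*, 2nd ed., Oxford 1986 — Thm 5.13,
  §5.20.
-/

noncomputable section

open Complex Finset Filter Asymptotics
open scoped Real

namespace Literature.NumberTheory.LFunctions

/-- **The fourth-derivative (exponent pair `(1/14, 11/14)`) bound for Bourgain's sum with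
`F = log`**: there is an absolute `C ≥ 0` with
`‖∑_{M/2 ≤ m ≤ M} e(T log(m/M))‖ ≤ C (M^{5/7} T^{1/14} + M^{29/28} T^{-1/14})` for all `T ≥ 1`,
`M ≥ 1` (from `Literature.NumberTheory.LFunctions.VdC.norm_sum_Icc_cpow_mul_I_le` with `t = 2πT`, `(2π)^{1/14} ≤ 2π ≤ 8`,
`(2πT)^{-1/14} ≤ T^{-1/14}`). [cite: Titchmarsh1986, Thm 5.13 (k = 4), §5.20] -/
theorem norm_bourgainSum_log_le_fourthDeriv :
    ∃ C : ℝ, 0 ≤ C ∧ ∀ T : ℝ, 1 ≤ T → ∀ M : ℝ, 1 ≤ M →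
      ‖bourgainSum Real.log T M‖
        ≤ C * (M ^ (5 / 7 : ℝ) * T ^ (1 / 14 : ℝ) + M ^ (29 / 28 : ℝ) * T ^ (-(1 / 14 : ℝ))) := by
  obtain ⟨C, hC, h⟩ := Literature.NumberTheory.LFunctions.VdC.norm_sum_Icc_cpow_mul_I_le
  refine ⟨8 * C, by positivity, ?_⟩
  intro T hT M hM
  have hπ3 : 3 < π := Real.pi_gt_three
  have hπ4 : π < 4 := Real.pi_lt_four
  have hT0 : 0 < T := by linarith
  have hM0 : 0 < M := by linarith
  have ht1 : (1 : ℝ) ≤ 2 * π * T := by nlinarith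
  have ht0 : (0 : ℝ) < 2 * π * T := by linarith
  rw [norm_bourgainSum_log hM0 T]
  have hmain := h (2 * π * T) ht1 M hM
  refine hmain.trans ?_
  -- compare `(2πT)^{±1/14}` with `T^{±1/14}`
  have h2π : (1 : ℝ) ≤ 2 * π := by linarith
  have hA : (2 * π * T) ^ (1 / 14 : ℝ) ≤ 8 * T ^ (1 / 14 : ℝ) := by
    rw [Real.mul_rpow (by linarith) hT0.le]
    have h' : (2 * π) ^ (1 / 14 : ℝ) ≤ 8 := by
      calc (2 * π) ^ (1 / 14 : ℝ) ≤ (2 * π) ^ (1 : ℝ) :=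
            Real.rpow_le_rpow_of_exponent_le h2π (by norm_num)
        _ = 2 * π := Real.rpow_one _
        _ ≤ 8 := by linarith
    exact mul_le_mul_of_nonneg_right h' (by positivity)
  have hB : (2 * π * T) ^ (-(1 / 14 : ℝ)) ≤ T ^ (-(1 / 14 : ℝ)) := by
    apply Real.rpow_le_rpow_of_nonpos hT0 _ (by norm_num)
    nlinarith
  have hX : 0 ≤ M ^ (5 / 7 : ℝ) := by positivity
  have hY : 0 ≤ M ^ (29 / 28 : ℝ) := by positivity
  calc C * (M ^ (5 / 7 : ℝ) * (2 * π * T) ^ (1 / 14 : ℝ)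
        + M ^ (29 / 28 : ℝ) * (2 * π * T) ^ (-(1 / 14 : ℝ)))
      ≤ C * (M ^ (5 / 7 : ℝ) * (8 * T ^ (1 / 14 : ℝ)) + M ^ (29 / 28 : ℝ) * T ^ (-(1 / 14 : ℝ))) := by
        apply mul_le_mul_of_nonneg_left _ hC
        exact add_le_add (mul_le_mul_of_nonneg_left hA hX) (mul_le_mul_of_nonneg_left hB hY)
    _ ≤ 8 * C * (M ^ (5 / 7 : ℝ) * T ^ (1 / 14 : ℝ) + M ^ (29 / 28 : ℝ) * T ^ (-(1 / 14 : ℝ))) := by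
        have h1 : 0 ≤ M ^ (5 / 7 : ℝ) * T ^ (1 / 14 : ℝ) := by positivity
        have h2 : 0 ≤ M ^ (29 / 28 : ℝ) * T ^ (-(1 / 14 : ℝ)) := by positivity
        nlinarith

/-- **(3.19) for `F = log` in the range `1 ≤ M ≤ T^{12/31}`, from the fourth-derivative test**
(replacing Bourgain's use of the exponent pair `(1/9, 13/18)`, eq. (4.2), on this range): there is
`C` with `‖S‖ ≤ C M^{1/2} T^{13/84}` for `T ≥ 1`, `1 ≤ M ≤ T^{12/31}`. The calculation:
`M^{5/7} T^{1/14} = M^{1/2} · M^{3/14} T^{1/14} ≤ M^{1/2} T^{36/434 + 31/434} = M^{1/2} T^{67/434}`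
and `67/434 < 13/84`; `M^{29/28} T^{-1/14} = M^{1/2} · M^{15/28} T^{-1/14} ≤ M^{1/2} T^{59/434}`.
[cite: BourgainJAMS2017, §5 (the range `[0, 12/31]` of the "calculation")] -/
theorem Bourgain2017_eq319_log_small :
    ∃ C : ℝ, ∀ T : ℝ, 1 ≤ T → ∀ M : ℝ, 1 ≤ M → M ≤ T ^ (12 / 31 : ℝ) →
      ‖bourgainSum Real.log T M‖ ≤ C * Real.sqrt M * T ^ (13 / 84 : ℝ) := by
  obtain ⟨C, hC, h⟩ := norm_bourgainSum_log_le_fourthDeriv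
  refine ⟨2 * C, ?_⟩
  intro T hT M hM hMT
  have hT0 : 0 < T := by linarith
  have hM0 : 0 < M := by linarith
  refine (h T hT M hM).trans ?_
  have hsq : Real.sqrt M = M ^ (1 / 2 : ℝ) := Real.sqrt_eq_rpow M
  -- first term
  have h1 : M ^ (5 / 7 : ℝ) * T ^ (1 / 14 : ℝ) ≤ Real.sqrt M * T ^ (13 / 84 : ℝ) := by
    have hα : M ^ (3 / 14 : ℝ) ≤ T ^ ((12 / 31 : ℝ) * (3 / 14)) := by
      rw [Real.rpow_mul hT0.le]
      exact Real.rpow_le_rpow hM0.le hMT (by norm_num)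
    have e1 : M ^ (5 / 7 : ℝ) = Real.sqrt M * M ^ (3 / 14 : ℝ) := by
      rw [hsq, ← Real.rpow_add hM0]; norm_num
    rw [e1, mul_assoc]
    apply mul_le_mul_of_nonneg_left _ (Real.sqrt_nonneg _)
    calc M ^ (3 / 14 : ℝ) * T ^ (1 / 14 : ℝ) ≤ T ^ ((12 / 31 : ℝ) * (3 / 14)) * T ^ (1 / 14 : ℝ) :=
          mul_le_mul_of_nonneg_right hα (by positivity)
      _ = T ^ ((12 / 31 : ℝ) * (3 / 14) + 1 / 14) := (Real.rpow_add hT0 _ _).symm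
      _ ≤ T ^ (13 / 84 : ℝ) := Real.rpow_le_rpow_of_exponent_le hT (by norm_num)
  -- second term
  have h2 : M ^ (29 / 28 : ℝ) * T ^ (-(1 / 14 : ℝ)) ≤ Real.sqrt M * T ^ (13 / 84 : ℝ) := by
    have hα : M ^ (15 / 28 : ℝ) ≤ T ^ ((12 / 31 : ℝ) * (15 / 28)) := by
      rw [Real.rpow_mul hT0.le]
      exact Real.rpow_le_rpow hM0.le hMT (by norm_num)
    have e1 : M ^ (29 / 28 : ℝ) = Real.sqrt M * M ^ (15 / 28 : ℝ) := by
      rw [hsq, ← Real.rpow_add hM0]; norm_num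
    rw [e1, mul_assoc]
    apply mul_le_mul_of_nonneg_left _ (Real.sqrt_nonneg _)
    calc M ^ (15 / 28 : ℝ) * T ^ (-(1 / 14 : ℝ))
        ≤ T ^ ((12 / 31 : ℝ) * (15 / 28)) * T ^ (-(1 / 14 : ℝ)) :=
          mul_le_mul_of_nonneg_right hα (by positivity)
      _ = T ^ ((12 / 31 : ℝ) * (15 / 28) + -(1 / 14 : ℝ)) := (Real.rpow_add hT0 _ _).symm
      _ ≤ T ^ (13 / 84 : ℝ) := Real.rpow_le_rpow_of_exponent_le hT (by norm_num)
  have h0 : 0 ≤ Real.sqrt M * T ^ (13 / 84 : ℝ) := by positivity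
  calc C * (M ^ (5 / 7 : ℝ) * T ^ (1 / 14 : ℝ) + M ^ (29 / 28 : ℝ) * T ^ (-(1 / 14 : ℝ)))
      ≤ C * (Real.sqrt M * T ^ (13 / 84 : ℝ) + Real.sqrt M * T ^ (13 / 84 : ℝ)) :=
        mul_le_mul_of_nonneg_left (add_le_add h1 h2) hC
    _ = 2 * C * Real.sqrt M * T ^ (13 / 84 : ℝ) := by ring

/-- **(5.1) for `F = log` from Theorem 4 and (4.1) only** (Bourgain §5, with the exponent pair
(4.2) replaced by the proved fourth-derivative bound `Bourgain2017_eq319_log_small` on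
`α ≤ 12/31`): Theorem 4 covers `17/42 ≤ α ≤ 1/2`, Huxley's (4.1) covers `12/31 < α < 17/42`
(`⊂ (12/31, 332/819]`), and the fourth-derivative test covers `0 ≤ α ≤ 12/31`.
[cite: BourgainJAMS2017, §5] -/
theorem Bourgain2017_eq51_log_of_theorem4_of_eq41 (h4 : Bourgain2017_theorem4_log)
    (h41 : Bourgain2017_eq41_log) : Bourgain2017_eq51_log := by
  intro ε hε
  obtain ⟨C₁, T₁, H₁⟩ := h4 ε hε
  obtain ⟨C₂, T₂, H₂⟩ := h41 ε hε
  obtain ⟨C₃, H₃⟩ := Bourgain2017_eq319_log_small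
  refine ⟨|C₁| + |C₂| + |C₃|, max (max T₁ T₂) 2, ?_⟩
  intro T hT M hM1 hMT
  have hT₁ : T₁ ≤ T := le_trans ((le_max_left _ _).trans (le_max_left _ _)) hT
  have hT₂ : T₂ ≤ T := le_trans ((le_max_right _ _).trans (le_max_left _ _)) hT
  have hT2 : (2 : ℝ) ≤ T := le_trans (le_max_right _ _) hT
  have hT1 : (1 : ℝ) ≤ T := by linarith
  have hTpos : (0 : ℝ) < T := by linarith
  have hMpos : (0 : ℝ) < M := by linarith
  have hY : 0 ≤ Real.sqrt M * T ^ (13 / 84 + ε) := by positivity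
  have hC₁ : |C₁| ≤ |C₁| + |C₂| + |C₃| := by linarith [abs_nonneg C₂, abs_nonneg C₃]
  have hC₂ : |C₂| ≤ |C₁| + |C₂| + |C₃| := by linarith [abs_nonneg C₁, abs_nonneg C₃]
  have hC₃ : |C₃| ≤ |C₁| + |C₂| + |C₃| := by linarith [abs_nonneg C₁, abs_nonneg C₂]
  by_cases hA : T ^ (17 / 42 : ℝ) ≤ M
  · -- Theorem 4
    calc ‖bourgainSum Real.log T M‖ ≤ C₁ * Real.sqrt M * T ^ (13 / 84 + ε) := H₁ T hT₁ M hA hMT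
      _ = C₁ * (Real.sqrt M * T ^ (13 / 84 + ε)) := by ring
      _ ≤ |C₁| * (Real.sqrt M * T ^ (13 / 84 + ε)) :=
          mul_le_mul_of_nonneg_right (le_abs_self _) hY
      _ ≤ (|C₁| + |C₂| + |C₃|) * (Real.sqrt M * T ^ (13 / 84 + ε)) :=
          mul_le_mul_of_nonneg_right hC₁ hY
      _ = (|C₁| + |C₂| + |C₃|) * Real.sqrt M * T ^ (13 / 84 + ε) := by ring
  · rw [not_le] at hA
    by_cases hB : T ^ (12 / 31 : ℝ) < M
    · -- Huxley (4.1): `T^{(4+103α)/128} = T^{1/32} M^{103/128} ≤ M^{1/2} T^{13/84}` for `α ≤ 332/819`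
      have hlogT : 0 < Real.log T := Real.log_pos (by linarith)
      have hpow : T ^ ((103 : ℝ) / 128 * (Real.log M / Real.log T)) = M ^ ((103 : ℝ) / 128) := by
        rw [Real.rpow_def_of_pos hTpos, Real.rpow_def_of_pos hMpos]
        congr 1
        field_simp
      have hsplit : T ^ ((4 + 103 * (Real.log M / Real.log T)) / 128 + ε) =
          T ^ (1 / 32 + ε) * M ^ ((103 : ℝ) / 128) := by
        rw [← hpow, ← Real.rpow_add hTpos]
        congr 1
        ring
      have h39 : M ^ ((39 : ℝ) / 128) ≤ T ^ ((83 : ℝ) / 672) := by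
        calc M ^ ((39 : ℝ) / 128) ≤ (T ^ (17 / 42 : ℝ)) ^ ((39 : ℝ) / 128) :=
              Real.rpow_le_rpow hMpos.le hA.le (by norm_num)
          _ = T ^ ((17 / 42 : ℝ) * (39 / 128)) := (Real.rpow_mul hTpos.le _ _).symm
          _ ≤ T ^ ((83 : ℝ) / 672) := Real.rpow_le_rpow_of_exponent_le hT1 (by norm_num)
      have key : T ^ ((4 + 103 * (Real.log M / Real.log T)) / 128 + ε) ≤
          Real.sqrt M * T ^ (13 / 84 + ε) := by
        rw [hsplit, show M ^ ((103 : ℝ) / 128) = Real.sqrt M * M ^ ((39 : ℝ) / 128) by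
          rw [Real.sqrt_eq_rpow, ← Real.rpow_add hMpos]; norm_num]
        calc T ^ (1 / 32 + ε) * (Real.sqrt M * M ^ ((39 : ℝ) / 128))
            ≤ T ^ (1 / 32 + ε) * (Real.sqrt M * T ^ ((83 : ℝ) / 672)) := by gcongr
          _ = Real.sqrt M * (T ^ (1 / 32 + ε) * T ^ ((83 : ℝ) / 672)) := by ring
          _ = Real.sqrt M * T ^ (13 / 84 + ε) := by
              rw [← Real.rpow_add hTpos]
              congr 1
              ring
      calc ‖bourgainSum Real.log T M‖
          ≤ C₂ * T ^ ((4 + 103 * (Real.log M / Real.log T)) / 128 + ε) := H₂ T hT₂ M hB hMT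
        _ ≤ |C₂| * T ^ ((4 + 103 * (Real.log M / Real.log T)) / 128 + ε) :=
            mul_le_mul_of_nonneg_right (le_abs_self _) (by positivity)
        _ ≤ |C₂| * (Real.sqrt M * T ^ (13 / 84 + ε)) :=
            mul_le_mul_of_nonneg_left key (abs_nonneg _)
        _ ≤ (|C₁| + |C₂| + |C₃|) * (Real.sqrt M * T ^ (13 / 84 + ε)) :=
            mul_le_mul_of_nonneg_right hC₂ hY
        _ = (|C₁| + |C₂| + |C₃|) * Real.sqrt M * T ^ (13 / 84 + ε) := by ring
    · -- `M ≤ T^{12/31}`: the fourth-derivative test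
      rw [not_lt] at hB
      have key : Real.sqrt M * T ^ (13 / 84 : ℝ) ≤ Real.sqrt M * T ^ (13 / 84 + ε) :=
        mul_le_mul_of_nonneg_left (Real.rpow_le_rpow_of_exponent_le hT1 (by linarith))
          (Real.sqrt_nonneg _)
      calc ‖bourgainSum Real.log T M‖
          ≤ C₃ * Real.sqrt M * T ^ (13 / 84 : ℝ) := H₃ T hT1 M hM1 hB
        _ = C₃ * (Real.sqrt M * T ^ (13 / 84 : ℝ)) := by ring
        _ ≤ |C₃| * (Real.sqrt M * T ^ (13 / 84 : ℝ)) :=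
            mul_le_mul_of_nonneg_right (le_abs_self _) (by positivity)
        _ ≤ |C₃| * (Real.sqrt M * T ^ (13 / 84 + ε)) :=
            mul_le_mul_of_nonneg_left key (abs_nonneg _)
        _ ≤ (|C₁| + |C₂| + |C₃|) * (Real.sqrt M * T ^ (13 / 84 + ε)) :=
            mul_le_mul_of_nonneg_right hC₃ hY
        _ = (|C₁| + |C₂| + |C₃|) * Real.sqrt M * T ^ (13 / 84 + ε) := by ring

/-- **`Literature.NumberTheory.LFunctions.bourgain_subconvexity` from Theorem 4, (4.1) and (4.3)** (the exponent pair (4.2)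
being supplied by the proved fourth-derivative test): the current frontier of the discharge of
Bourgain's Theorem 5. [cite: BourgainJAMS2017, Theorem 5] -/
theorem bourgain_subconvexity_of_theorem4_of_eq41_of_eq43 (h4 : Bourgain2017_theorem4_log)
    (h41 : Bourgain2017_eq41_log) (h43 : Bourgain2017_eq43) : bourgain_subconvexity :=
  bourgain_subconvexity_of_eq43_of_eq51 h43 (Bourgain2017_eq51_log_of_theorem4_of_eq41 h4 h41)

/-- **`Literature.NumberTheory.LFunctions.bourgain_subconvexity` from Theorem 4, (4.1) and the approximate functional equation
(4.17.1)**: the current frontier of the discharge of Bourgain's Theorem 5 — decoupling /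
Bombieri–Iwaniec–Huxley (Theorem 4), Huxley 1993 Thm 3 ((4.1)) and the Hardy–Littlewood
approximate functional equation (Titchmarsh (4.17.1)). [cite: BourgainJAMS2017, Theorem 5] -/
theorem bourgain_subconvexity_of_theorem4_of_eq41_of_eq4171 (h4 : Bourgain2017_theorem4_log)
    (h41 : Bourgain2017_eq41_log) (h4171 : Titchmarsh1986_eq4171) : bourgain_subconvexity :=
  bourgain_subconvexity_of_theorem4_of_eq41_of_eq43 h4 h41 (Bourgain2017_eq43_of_eq4171 h4171)

end Literature.NumberTheory.LFunctions
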